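import Literature.Geometry.Lorentzian.KlainermanSzeftel2021.Bootstrap

/-!
# Klainerman–Szeftel / Giorgi–Klainerman–Szeftel, Kerr stability for `|a| ≪ m`: the proof DAG below Theorems M1–M8, typed

CITATION HEADER (lean-in-tree rule 2026-08-18).  This module is a TYPED SKELETON (statement shapes + the
bookkeeping implications between them, never the analysis) of the ARCHITECTURE of the published proof

* [KS]   S. Klainerman, J. Szeftel, *Kerr stability for small angular momentum*, arXiv:2104.11857 (v1, 2021; TeX
         source `Main-Kerr-arxiv.tex`, whose line numbers `KS l.N` / `l.N` are quoted) = bib key `KlainermanSzeftel2021`;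
         journal record Pure Appl. Math. Q. **19** (2023) no. 3, 791–1678 = bib key `KlainermanSzeftel2023` (refereed;
         read since v8 in the authors' accepted manuscript HAL hal-04280491, `[J] p. N` = its PDF page; acquisition request
         acq-07685 of the audit cell).
* [GKS]  E. Giorgi, S. Klainerman, J. Szeftel, *Wave equations estimates and the nonlinear stability of slowly rotating
         Kerr black holes*, arXiv:2205.14808 (2022; TeX `FinalKerrarxivversion.tex`, lines `GKS l.N`) = bib key
         `GiorgiKlainermanSzeftel2022`; journal record Pure Appl. Math. Q. **20** (2024) no. 7, 2865–3849 = bib key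
         `GiorgiKlainermanSzeftel2024` (refereed), read in the authors' version HAL hal-05348127 (pages `HAL p.N`):
         arXiv Thm 11.7.1 = print Thm 11.7.1 (HAL p.527); arXiv Thm 12.4.4 = print Thm 12.4.5 (HAL p.585);
         arXiv Thm 13.6.3 = print Thm 13.6.3 (HAL p.627).
* Companion texts named in docstrings (never used as facts): S. Klainerman, J. Szeftel, arXiv:1911.00697 ("GCM1") and
  arXiv:1912.12195 ("GCM2") = Ann. PDE 8 (2022) papers 17, 18 (journal versions read since v8 as HAL hal-03797538 /
  hal-03797541); D. Shen, arXiv:2205.12336 = bib key `Shen2023GCM`;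
  S. Klainerman, J. Szeftel, Ann. Math. Studies 210 (2020) = bib key `KlainermanSzeftel2020` ("KS-Schw").

WHAT IS REPRODUCED, and in what sense.  On top of `Literature.Geometry.Lorentzian.KlainermanSzeftel2021.Bootstrap` (the bootstrap /
continuity layer of KS ch. 3: the carrier `Setting`, the constants, BA-B/BA-D, Theorems M0–M8 as statement SHAPES
`def … : Prop`, and the proved continuity argument), this file types the NEXT LAYER of the printed proof:
* KS ch. 5 → 6 → 7: Prop 5.5.1 (`Prop551`, `k ≤ k_* − 12`, `k_* = k_small + 80`), Prop 5.7.3 (`Prop573`, the outgoing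
  PG frame of `ℳ^(ext)` on `Σ_*`, `k ≤ k_* − 15`), its ch.-6 restatement Prop 6.4.3 (`Prop643`, `k ≤ k_* = k_small+60`,
  restatement = the named hypothesis `Edge643`), Prop 6.4.4 (`Prop644`, `k ≤ k_* − 8`: its two printed displays),
  Prop 5.3.1 (`Prop531`, `k ≤ k_* − 7`, the `Σ_*`-flux of `Γ_b`), the one-sentence bridge "which implies Theorem M4"
  (KS l.15440) as the named norm-assembly hypothesis `Edge644` (Prop 6.4.4 + Theorem M1 item 2 + Prop 5.3.1 ⇒
  `^(ext)𝔇_{k_small+40}`, whose five components are KS l.5826–5830), and the ch.-7 transport scheme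
  (`Ch7Scheme`), each over the abstract carrier with its DERIVATIVE BUDGET explicit; PROVED (pure integer bookkeeping +
  monotonicity, `omega`): `thmM3fromM1M2_of_prop551`, `thmM3_of_prop551`, `prop643_of_prop573`, `thmM4_of_prop644`
  (from M1, M2, Prop 5.5.1, Prop 5.7.3, `Edge643`, Prop 5.3.1, Prop 6.4.4, `Edge644` — Theorem M3 is not an input of
  the M4 edge, exactly as in KS §6.1 l.13499–13508), the range lemmas `kM4_le_kstar6_sub`, `kM4_le_kstar5_sub`, `thmM5_of_ch7`.
* The cross-paper edges "Theorems M1 and M2 are proved in [GKS]" (KS l.7639) as NAMED HYPOTHESIS NODES over an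
  abstract `GKSSide` (`EdgeM1hyp`, `EdgeM1concl`, `EdgeM2hyp`, `EdgeM2flux`, `EdgeM2int`) next to the [GKS] theorem
  shapes `ThmGKS1171`, `ThmGKS1244`, with the PROVED compositions `thmM1_of_gks`, `thmM2_of_gks`.  Each hypothesis
  node isolates one translation step between the two papers that the audit cell records as disputed or unsourced
  (u-decay exponent of the hypotheses; `τ` vs `u, u̲`; derivative ranges; the `^(int)𝔇 + ^(top)𝔇 [α̲]` clause of M2,
  which has no counterpart in [GKS] Thm 12.4.4/12.4.5 and, v8, is absent from the refereed statement of M2; the gauge hypothesis (12.1.3) of [GKS] ch. 12) — so that the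
  kernel certifies exactly what the printed chain consumes, and nothing is asserted.
* KS §9.4.7–9.4.8 (Theorem M8 via the Main PT-Theorem 9.4.10): the iteration statements as `Prop`s over an abstract
  `Ch9Iteration` (FORM A = KS Thm 9.4.15 as printed in v1; FORM B′ = [GKS] Thm 13.6.3 / (13.6.8)), consumed by
  `Literature.Geometry.Lorentzian.KlainermanSzeftel2021.IterationAbsorption`-style real arithmetic elsewhere.
* `KSArchitecture` — a bare v1 bookkeeping record (superset carrier `calU ⊇ 𝒰`, BA-B without the `(m, a)` clause),
  kept only because the cell's `Bridge` module instantiates it; no statement is asserted over it.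
Every node is a `def … : Prop` over explicit carrier binders — a PREDICATE on settings, i.e. a hypothesis node
(named-fact semantics do not apply: over an arbitrary carrier none of these Props is a theorem, no `_holds` is
expected); the `[cite: …]` tags record the PROVENANCE of each shape (which display it transcribes, TeX line).

STATUS OF THE SOURCES.  [KS] and [GKS] are refereed publications; this module neither re-proves nor disputes any
analytic estimate.  It was written by the audit cell `pub-kerr` (typed skeleton + `|a| ≪ M` census), whose rule is
that the manuscripts under audit enter only as explicit hypotheses; the cell's line-referenced node census (99 nodes,
167 edges, DAG-STATS, forward-reference map, gap localisation) lives in its LEMMAS.md / GAPS.md and in the staging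
package's evaluator-checked registry, NOT here (census data is not mathematics).

RELATION TO EXISTING TREE MATERIAL.  None claimed: `Literature.Geometry.Lorentzian.klainerman_szeftel_kerr_stability_small_a_cauchy`
(`StabilityCauchy.lean`) is the paper's end-statement as a named fact over `InitialDataSet`; the shapes here live over
the abstract bookkeeping carrier of `Bootstrap` and a bridge between the two typings would be a new, unproved item.
Nothing here is Final-State-Conjecture progress.

STAGING.  = the cell's staged `KerrSkeleton/Dag.lean` v14 (2026-08-19: v3 + the retyping of `Prop644` to its printed displays,
the new nodes `Prop531` / `Edge644`, the `δ_extra` correction = v4; + the SUPERSEDED note on `Ch9Iteration.Thm9410_of_children`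
and two registry nodes for the un-numbered §9.4.8 displays = v5; + locator / precision notes on `Edge644` (Theorem M1 item 2 =
l.6685–6687; `Γ_b ∋ η` vs `Ȟ`), `Lemma9413` (statement vs proof) and `BAch9` ((9.4.20) never initiated/closed in print) and three
registry nodes KS9.4.13-sup / BA-PT / KS9.6.6 = v6; + the `Lemma9413` v7 note and registry nodes E-9413 / KS9.4.13-Brate for the
cell's exponent count behind l.24420–24425 = v7; + the journal reading (registry re-tag U → X of the citations KS5.1.5 / KS8.1.4 / KS8.1.9,
resolved to the refereed GCM1/GCM2 texts held as HAL manuscripts, and the `EdgeM2int` / `Thm9415_formA` print-status notes) = v8; + the EXACT integer typing `I.kL ≤ 2 * J` of the printed floor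
"k_L/2 ≤ J" in `Ch9Iteration.Thm1363_formB` / `KS_Cor_9_4_21_of_GKS_13_6_3` (previously ℕ-division `I.kL / 2 ≤ J`, one J-level wider
than print for even `k_large`; DIVERGENCE DV-f3-11, binder types only — the consumer `IterationStep` v2 takes the printed floor) and the
`kL` locator l.1795 = v9; + the `Thm9410` consumer note and two registry nodes KS9.4.3-S3 / KS9.4.3-S3-in for the cell's weight count
behind display (9.4.17) of the proof of Theorem M8 (finding E28, `GiorgiKlainermanSzeftel2022.ExteriorWeightLedger`) = v10; + the `Thm9410` v11 clause and registry node KS9.7.3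
([KS] Prop 9.7.2 / Cor 9.7.3, the printed `Σ_*`-sourced transport serving `P̌, B̲, A̲` in (9.4.17),
`KlainermanSzeftel2021.CylinderTransportCount`) = v11; + registry K-node KS8.4-S8 = the second half of Step 8 of the proof of Theorem M6
([KS] §8.4, l.21551–21590 = [J] HAL hal-04280491 p0550 L28–53: display (8.4.31) and the concluding sentence charging the last
frame→Ricci derivative from the display index; finding E31, `KlainermanSzeftel2021.InitializationLedger`) = v12; + the KS8.4-S8
locator extension (E31 read at print level, reading R1: the ingoing analog of Cor 2.2.5 cited by (8.4.31) is printed five times —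
lossy on `f` at four of them ([KS] §9.4.3 Step 5 l.24206–24229 = [J] p0620 L2–39, [J] p0226 L47–58, v1 l.8889–8901 / 8944–8998, [KS-Schw]
book p0436), in PT form with a loss-free third equation at the fifth ([J] p0213 L2–8; wording REFEREE #46 P17, v14) — so the concluding
sentence l.21582–21586 is one derivative short on {Ξ', tr X̌', X̂'} on `ℳint` / `ℳtop` as printed; prices (b′) unprinted internal
sharpening / (c) Main-Theorem data index +1, statement-adjacent; class E OPEN-PRICED, not gate-red; `KlainermanSzeftel2021.FrameChangeLedger`,
`KlainermanSzeftel2021.TransitionLossLedger`) = v13; + the registry re-kind U → E of KS9.4.13-Brate (DERIVABLE-NOT-PRINTED: the `ε₀`-size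
`r^{−7/2}`-type bound for `B` on the extended `ℳext` that E-9413's B-half needs is printed by no statement of [KS] / [GKS] / [GCM1] /
[GCM2] / [Shen] but assembles from printed statements of [KS] — the refereed [J] Prop 6.5.4 two-branch profile (HAL hal-04280491 p0407
L4–13), Prop 5.7.3, the curvature item (2.2.21) of Prop 2.2.3 = [GCM1] Prop 3.3 — by an unprinted re-run of Theorem M7 Step 18's printed
transfer sentence (l.23045–23053 = [J] p0592 L44–53) on one more weight; residual unprinted = the choice `δ_B ∈ (2δ_dec, T)` + the
applications, a price; E-9413 class E OPEN-PRICED unchanged; `KlainermanSzeftel2021.FrameTransferCount`), the new registry nodes KS8.5-S18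
(Theorem M7 Step 18) / KS2.2.3 (Prop 2.2.3, cross-paper import, parents by the cell's RULE X223), registry 99 nodes / 167 edges, and the
`Lemma9413` B-half sentence below = v14 — no declaration
changed in v5–v8 or v10–v14, two binder types in v9; clean-built in the staging package,
0 sorry, axioms ⊆ {propext, Classical.choice, Quot.sound}), code unchanged except: namespace moved under the path, the node
registry and its `#guard`s omitted, provenance tags added, and section variables written as explicit binders.
-/

noncomputable section

namespace Literature.Geometry.Lorentzian.KlainermanSzeftel2021

/-- KS (3.4.6), l.6113: `k_small = ⌊k_large/2⌋ + 1` (same value as `Bootstrap.Constants.ksmall`).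
[cite: KlainermanSzeftel2021, eq. (3.4.6), TeX l.6113] -/
def kSmall (kLarge : ℕ) : ℕ := kLarge / 2 + 1

/-- COMPATIBILITY CARRIER (v1 bookkeeping record of the cell, kept field-stable because the cell's `Bridge` module
instantiates it).  Fields = the data KS §3.7 quantifies over: a type `Sp` of GCM-admissible spacetimes with `u_*`, `r_*`
(KS §3.2), the reference parameters `m0, a0`, the constants `ε0, δ_*, δ_dec, k_large` (KS §3.4.1, l.6054–6073), the eight
regional sup/decay norms of KS §3.3 as `Sp → ℕ → ℝ` (monotone in `k`: maxima over `𝔡^{≤k}`, l.5636–5988), opaque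
extension relations and conclusion predicates.  DEPRECATED as a node carrier: the canonical layer (𝒰, BA-B WITH the
`|m − m0| + |a − a0| ≤ ε` clause of (3.5.1) l.6354–6356, Theorems M0–M8, the continuity argument) is `Bootstrap.Setting`;
`BA` below omits that clause, hence `calU ⊇ 𝒰` only, and NO statement of this file is asserted over this record.
[cite: KlainermanSzeftel2021, §3.3–§3.7 (norms, constants, bootstrap assumptions), TeX l.5636–6764] -/
structure KSArchitecture where
  Sp : Type
  ustar : Sp → ℝ
  rstar : Sp → ℝ
  m0 : ℝ
  a0 : ℝ
  ε0 : ℝ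
  δstar : ℝ
  δdec : ℝ
  kLarge : ℕ
  Bstar : Sp → ℕ → ℝ
  Bext : Sp → ℕ → ℝ
  Bint : Sp → ℕ → ℝ
  Btop : Sp → ℕ → ℝ
  Dstar : Sp → ℕ → ℝ
  Dext : Sp → ℕ → ℝ
  Dint : Sp → ℕ → ℝ
  Dtop : Sp → ℕ → ℝ
  Extends : Sp → Sp → Prop
  M7Ext : Sp → Sp → Prop
  M1Concl : Sp → Prop
  M2Concl : Sp → Prop
  MainConcl : Prop
  ε0_pos : 0 < ε0
  /-- the decay norms are maxima over `𝔡^{≤k}` (KS §3.3.1–3.3.4, l.5636–5988), hence monotone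
  in `k`; an obligation on instances, used in `(3.7.1)` and in Thm M3 ⇐ Prop 5.5.1. -/
  D_mono : ∀ M : Sp, Monotone (Dstar M) ∧ Monotone (Dext M) ∧ Monotone (Dint M) ∧ Monotone (Dtop M)

namespace KSArchitecture

/-- KS l.6741, Def 3.7.1 (l.6744–6760): `ε = ε₀^{2/3}`. [cite: KlainermanSzeftel2021, Def 3.7.1, TeX l.6741] -/
def ε (A : KSArchitecture) : ℝ := A.ε0 ^ ((2 : ℝ) / 3)

/-- KS (3.4.6): `k_small`. [cite: KlainermanSzeftel2021, eq. (3.4.6), TeX l.6113] -/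
def kS (A : KSArchitecture) : ℕ := kSmall A.kLarge

/-- KS §3.3.5 "Combined norms", l.5989–5997 (unnumbered display):
`𝔑^{(Sup)}_k := *𝔅_k + ext𝔅_k + int𝔅_k + top𝔅_k`. [cite: KlainermanSzeftel2021, §3.3.5, TeX l.5989–5997] -/
def NSup (A : KSArchitecture) (M : A.Sp) (k : ℕ) : ℝ := A.Bstar M k + A.Bext M k + A.Bint M k + A.Btop M k

/-- KS §3.3.5, l.5996: `𝔑^{(Dec)}_k := *𝔇_k + ext𝔇_k + int𝔇_k + top𝔇_k`. [cite: KlainermanSzeftel2021, §3.3.5, TeX l.5996] -/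
def NDec (A : KSArchitecture) (M : A.Sp) (k : ℕ) : ℝ := A.Dstar M k + A.Dext M k + A.Dint M k + A.Dtop M k

/-- KS (3.4.5), l.6103–6106: dominant condition of `r` on `S_*`:
`r_* = δ_* ε₀⁻¹ u_*^{1+δ_dec}`. [cite: KlainermanSzeftel2021, eq. (3.4.5), TeX l.6103–6106] -/
def DominantR (A : KSArchitecture) (M : A.Sp) : Prop :=
  A.rstar M = A.δstar * A.ε0⁻¹ * (A.ustar M) ^ (1 + A.δdec)

/-- KS (3.5.1)–(3.5.2), l.6354–6363, with `ε = ε₀^{2/3}` (Def 3.7.1):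
**BA-B** `𝔑^{(Sup)}_{k_large} ≤ ε`, **BA-D** `𝔑^{(Dec)}_{k_small} ≤ ε` (WITHOUT the `(m, a)` clause — see the
structure docstring). [cite: KlainermanSzeftel2021, eq. (3.5.1)–(3.5.2), TeX l.6354–6363] -/
def BA (A : KSArchitecture) (M : A.Sp) : Prop := A.NSup M A.kLarge ≤ A.ε ∧ A.NDec M A.kS ≤ A.ε

/-- KS Def 3.7.1, l.6744–6760: `M ∈ 𝒰(u_*)` (written `ℵ(u_*)` at l.6785–6808):
`u_*` is the value of `u` on `S_*`, (3.4.5) holds, and BA-B, BA-D hold with `ε = ε₀^{2/3}`.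
[cite: KlainermanSzeftel2021, Def 3.7.1, TeX l.6744–6760] -/
def MemAleph (A : KSArchitecture) (u : ℝ) (M : A.Sp) : Prop := A.ustar M = u ∧ A.DominantR M ∧ A.BA M

/-- KS Def 3.7.2, l.6762–6764: `𝒰 := { u_* ≥ 0 | 𝒰(u_*) ≠ ∅ }` (superset reading, see `BA`).
[cite: KlainermanSzeftel2021, Def 3.7.2, TeX l.6762–6764] -/
def calU (A : KSArchitecture) : Set ℝ := {u : ℝ | 0 ≤ u ∧ ∃ M : A.Sp, A.MemAleph u M}

end KSArchitecture

end Literature.Geometry.Lorentzian.KlainermanSzeftel2021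

namespace Literature.Geometry.Lorentzian.KlainermanSzeftel2021.Dag


/-! ## Layer 2 over `Bootstrap.Setting`: the chapter-5/6/7 nodes of [KS] with their derivative budgets

KS fixes a chapter-local `k_*`: ch. 5 `k_* = k_small + 80` (`eq:valueofkstarinchapter5forproofThmM3`), ch. 6
`k_* = k_small + 60` (l.15440–15447), and proves its propositions for `k ≤ k_* − 12` (Prop 5.5.1), `k ≤ k_* − 15`
(Prop 5.7.3), resp. `k ≤ k_*` (Prop 6.4.3), `k ≤ k_* − 8` (Prop 6.4.4).  The only kernel content of the edges below is
this integer bookkeeping plus monotonicity of the norms in `k`; the propositions themselves are hypothesis nodes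
(analytic, proved in the source, typed verbatim in LEMMAS.md §2/§2b).  v3: the ch.-6 input from ch. 5 is Prop 6.4.3
⇐ Prop 5.7.3 (outgoing PG frame of `ℳ^(ext)` on `Σ_*`), carried by the abstract `Ch5Side`, NOT Theorem M3's `^*𝔇`
(REFEREE #8 V4).  v4: Prop 6.4.4 (`Prop644`) concludes only its two printed displays (`pg644`), and the one-sentence bridge
"which implies Theorem M4" (l.15440) is the named hypothesis `Edge644`, which also consumes Theorem M1 (item 2, the `A`-jet)
and Prop 5.3.1 (`Prop531`, `k ≤ k_* − 7`, the `Σ_*`-flux of `Γ_b ∋ η` (⇒ `Ȟ` after the frame identification of §5.7.1)) —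
REFEREE #11 V5, #14 N-1. -/

open Literature.Geometry.Lorentzian.KlainermanSzeftel2021.Bootstrap

section Layer2

/-- The conclusion of Theorem M1 for the spacetime `X` (body of `Bootstrap.ThmM1`, KS l.6670–6689).
[cite: KlainermanSzeftel2021, Theorem M1, TeX l.6670–6689] -/
def M1Concl {c : Constants} (K : LesConstants) (S : Setting c) (X : S.M) : Prop :=
  ∃ δextra : ℝ, c.δdec < δextra ∧ S.m1Sup X δextra ≤ K.cM1 * c.ε0 ∧
    S.m1Flux X δextra ≤ (K.cM1 * c.ε0) ^ 2 ∧ S.m1A X δextra ≤ K.cM1 * c.ε0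

/-- The conclusion of Theorem M2 for `X` (body of `Bootstrap.ThmM2`, KS l.6691–6697).
[cite: KlainermanSzeftel2021, Theorem M2, TeX l.6691–6697] -/
def M2Concl {c : Constants} (K : LesConstants) (S : Setting c) (X : S.M) : Prop := S.m2Dec X ≤ K.cM2 * c.ε0 ∧ S.m2Flux X ≤ (K.cM2 * c.ε0) ^ 2

/-- KS ch. 5: `k_* = k_small + 80` (`eq:valueofkstarinchapter5forproofThmM3`, quoted l.11873).
[cite: KlainermanSzeftel2021, §5.5 value of k_* in chapter 5, TeX l.11873] -/
def kstar5 (c : Constants) : ℕ := c.ksmall + 80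

/-- KS ch. 6: `k_* = k_small + 60` (Prop 6.4.4, l.15442–15447: "for all k ≤ k_* − 8").
[cite: KlainermanSzeftel2021, §6.4 value of k_* in chapter 6, TeX l.15443] -/
def kstar6 (c : Constants) : ℕ := c.ksmall + 60

/-- **Node KS5.5.1 + E-551** (KS Prop 5.5.1 `prop:decayonSigamstarofallquantities`, l.11853–11870, and the
Remark l.11873, verbatim: "(5.5.1) can be rewritten as `^*𝔇_k ≲ ε0` for `k ≤ k_* − 12`.  Thus, since
`k_* = k_small + 80` …, Proposition 5.5.1 yields in particular `^*𝔇_{k_small+60} ≲ ε0` and thus concludes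
the proof of Theorem M3").  Hypotheses as used in ch. 5: the bootstrap assumptions restricted to `Σ_*` (Ref 1,
l.9555–9583) and the conclusions of Theorems M1, M2 on `Σ_*` (Ref 2, l.9588–9618).  Children in LEMMAS.md:
Prop 5.3.1, Prop 5.4.3, Prop 5.4.7, Cor 5.2.9, Theorem M2 (for α̲), uniformization inputs KS5.1.2/5.1.5/5.1.7.
[cite: KlainermanSzeftel2021, Proposition 5.5.1 and Remark, TeX l.11853–11873] -/
def Prop551 {c : Constants} (K : LesConstants) (S : Setting c) (C551 : ℝ) : Prop := IDLWeak S → ∀ X : S.M, BA_B S X → BA_D S X →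
  M1Concl K S X → M2Concl K S X → ∀ k : ℕ, k ≤ kstar5 c - 12 → S.starD X k ≤ C551 * c.ε0

/-- **Carrier for nodes KS5.7.3 / KS6.4.3 / KS6.4.4 / KS5.3.1** (v3; v4 adds `pg644`, `flux531`).  KS Prop 5.7.3 (`prop:improvedesitmatesfortemporalframeofMextonSigmastar`,
l.12782–12800) bounds, on `Σ_*` and w.r.t. the OUTGOING PG FRAME OF `ℳ^(ext)` (primed quantities), five sup-type
displays at derivative level `k` (verbatim shapes): (1) `r u^{1+δ_dec}|𝔡^kΓ'_b| + r²u^{1/2+δ_dec}|𝔡^kΓ'_g| + r²u^{1+δ_dec}|𝔡^{k-1}∇₃Γ'_g|`;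
(2) `r²u^{1+δ_dec}|𝔡^k tr X̌'| + r³u^{1+δ_dec}|𝔡^k(D̄'·Ž'+2P̄')|`; (3) `r^{7/2+δ_extra}|𝔡^k B'| + r⁴u^{1/2+δ_dec}|𝔡^{k-1}∇₃B'|` (TeX `\dee` = `δ_extra`,
macro table l.413–415 — v3 misread it as `δ_B`, REFEREE #11 V6);
(4), (5) two `ℓ = 1`-mode bounds with weight `r⁵u^{1+δ_dec}` — abstracted as ONE number `pg573 X k` (their maximum).
KS Prop 6.4.3 (l.15416–15428) "restate[s] below Proposition 5.7.3" in the frame of `ℳ^(ext)` with the primes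
dropped (convention l.15410–15414, 15434) as three displays = (1), (2) + the second summand of (3), (4)+(5) merged via the
renormalised `[·]_ren` of Def l.15078–15082 (only `r^{7/2+δ_extra}|𝔡^k B'|` is omitted) — abstracted as `pg643 X k`.  The
fields are kept SEPARATE so that each restatement / norm assembly (frame identification + sub-collection) is a NAMED
HYPOTHESIS (`Edge643`, `Edge644`), not a definitional identity.  v4 (REFEREE #11 V5): `pg644 X k` = max of the TWO printed
displays of KS Prop 6.4.4 (l.15442–15451, sup over `ℳ^(ext)`); `flux531 X k` = the left side of KS Prop 5.3.1 (5.3.1)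
(l.10644–10650), `∫_{Σ_*} u^{2+2δ_dec} |𝔡_*^k Γ_b|²`, in the frame adapted to `Σ_*`.
[cite: KlainermanSzeftel2021, Propositions 5.7.3, 6.4.3, 6.4.4, 5.3.1 (displays), TeX l.12782–12800, 15416–15428, 15442–15451, 10644–10650] -/
structure Ch5Side {c : Constants} (S : Setting c) where
  /-- max of the five displays of KS Prop 5.7.3 at level `k` (primed PG frame of `ℳ^(ext)` on `Σ_*`). -/
  pg573 : S.M → ℕ → ℝ
  /-- max of the three displays of KS Prop 6.4.3 at level `k` (same quantities, primes dropped). -/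
  pg643 : S.M → ℕ → ℝ
  /-- max of the two displays of KS Prop 6.4.4 at level `k` (sup over `ℳ^(ext)`, outgoing PG frame of `ℳ^(ext)`; v4). -/
  pg644 : S.M → ℕ → ℝ
  /-- left side of KS (5.3.1) at level `k`: `∫_{Σ_*} u^{2+2δ_dec} |𝔡_*^k Γ_b|²` (frame adapted to `Σ_*`; v4). -/
  flux531 : S.M → ℕ → ℝ


/-- **Node KS5.3.1** (KS Prop 5.3.1, label `Prop.Flux-bb-vthb-eta-xib`, l.10644–10656, verbatim): "The following estimate
holds true for all `k ≤ k_* − 7`, `∫_{Σ_*} u^{2+2δ_dec} |𝔡_*^k Γ_b|² ≲ ε0²` (5.3.1).  We also have, for `k ≤ k_* − 10`,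
`‖Γ_b‖_{∞,k} ≲ ε0 r^{-1} u^{-1-δ_dec}` (5.3.2)."  Here `k_* = k_small + 80` (the ch.-5 value, l.11873).  Hypotheses as used
in §5.3 (l.10676–11104): the bootstrap assumptions on `Σ_*` (Ref 1), Theorems M1, M2 on `Σ_*` (Ref 2: `𝔮`, `∇_3𝔮`, `α̲`,
l.10681, l.10695), the dominance condition on `r` on `Σ_*`, the GCM conditions of `Σ_*`, the interpolation, commutator and
2D-Hodge lemmas of §§5.1–5.2.  Only (5.3.1) is carried (`flux531`).  A leaf S-node of the registry (child of KS5.5.1,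
KSsec5.6, KSsec5.7.3), since v4 ALSO a child of the edge node E-644 (the `Σ_*`-flux component of `^(ext)𝔇`).
[cite: KlainermanSzeftel2021, Proposition 5.3.1, TeX l.10644–10656] -/
def Prop531 {c : Constants} (K : LesConstants) (S : Setting c) (P : Ch5Side S) (C531 : ℝ) : Prop := IDLWeak S → ∀ X : S.M, BA_B S X → BA_D S X →
  M1Concl K S X → M2Concl K S X → ∀ k : ℕ, k ≤ kstar5 c - 7 → P.flux531 X k ≤ (C531 * c.ε0) ^ 2

/-- **Node KS5.7.3** (KS Prop 5.7.3, l.12782–12800; proof §5.7.5 l.13479–13489 from §§5.7.2–5.7.4 and §5.6, registry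
nodes KSsec5.7.2/3/4/5, KSsec5.6): for `k ≤ k_* − 15`, `k_* = k_small + 80`, the primed PG-frame quantities on `Σ_*`
are `≲ ε0`.  Hypotheses as used in §5.7 (l.12697–12703, 13034–13044): the bootstrap assumptions on `Σ_*`, Theorems
M1/M2 on `Σ_*` (Ref 2) and the conclusion of Prop 5.5.1 (`k ≤ k_* − 12`, invoked 4× in §5.7.3 and in §5.7.4).
[cite: KlainermanSzeftel2021, Proposition 5.7.3, TeX l.12782–12800] -/
def Prop573 {c : Constants} (K : LesConstants) (S : Setting c) (P : Ch5Side S) (C573 : ℝ) : Prop := IDLWeak S → ∀ X : S.M, BA_B S X → BA_D S X →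
  M1Concl K S X → M2Concl K S X → (∀ k : ℕ, k ≤ kstar5 c - 12 → S.starD X k ≤ K.cM3 * c.ε0) →
  ∀ k : ℕ, k ≤ kstar5 c - 15 → P.pg573 X k ≤ C573 * c.ε0

/-- **Edge node KS6.4.3 ⇐ KS5.7.3 (restatement)**: the three displays of Prop 6.4.3 are, display by display, among
the five of Prop 5.7.3 once the frame of `ℳ^(ext)` on `Σ_*` is identified with the primed frame of §5.7.1
(l.12712–12741) — KS l.15410: "we restate below Proposition 5.7.3 in the context of this chapter, i.e. with respect
to our current notations [primes dropped]".  Typed as domination of the abstract numbers; a hypothesis node (the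
frame identification is definitional in KS but not visible to this carrier).
[cite: KlainermanSzeftel2021, §6.1 restatement of Proposition 5.7.3, TeX l.15410–15414] -/
def Edge643 {c : Constants} (S : Setting c) (P : Ch5Side S) : Prop := ∀ (X : S.M) (k : ℕ), P.pg643 X k ≤ P.pg573 X k

/-- **Node KS6.4.3** (KS Prop 6.4.3, label `prop:improvedesitmatesfortemporalframeofMextonSigmastar-new`,
l.15416–15428): the same bounds for `k ≤ k_*`, `k_* = k_small + 60` (ch.-6 value, footnote l.15443).
[cite: KlainermanSzeftel2021, Proposition 6.4.3, TeX l.15416–15428] -/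
def Prop643 {c : Constants} (K : LesConstants) (S : Setting c) (P : Ch5Side S) (C643 : ℝ) : Prop := IDLWeak S → ∀ X : S.M, BA_B S X → BA_D S X →
  M1Concl K S X → M2Concl K S X → (∀ k : ℕ, k ≤ kstar5 c - 12 → S.starD X k ≤ K.cM3 * c.ε0) →
  ∀ k : ℕ, k ≤ kstar6 c → P.pg643 X k ≤ C643 * c.ε0

/-- **Node KS6.4.4** (KS Prop 6.4.4, label `prop:improvedesitmatesfortemporalframeofMexton-new`, l.15442–15451, verbatim):
"We have on `ℳ^(ext)`, for `k ≤ k_* − 8` [footnote l.15443: "Recall from (eq:valueofkstarinchapter6forproofThmM4) that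
`k_* = k_small + 60` in this chapter"],
`sup_{ℳext} ( r u^{1+δ_dec}|𝔡^kΓ_b| + (r²u^{1/2+δ_dec} + r u^{1+δ_dec})|𝔡^kΓ_g| + r²u^{1+δ_dec}|𝔡^{k-1}∇_3Γ_g| ) ≲ ε0`, and
`sup_{ℳext} r²u^{1+δ_dec}|𝔡^k tr X̌| + sup_{ℳext} r⁴u^{1/2+δ_dec}|𝔡^{k-1}∇_3 B| ≲ ε0`."  v4 (REFEREE #11 V5): the conclusion is
EXACTLY these two displays (`pg644 X k`) — no longer the full `^(ext)𝔇_k` (KS l.5826–5830, five components); the printed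
one-sentence bridge to Theorem M4 (l.15440) is the separate named hypothesis `Edge644`.
Inputs as used in ch. 6 (l.13499–13508 with Ref 1 l.13706 and Ref 2 l.13756; l.15416–15434): the bootstrap
assumptions on `ℳ^(ext)`, the estimates for `A` (and `𝔮`) of Theorem M1 on `ℳ^(ext)`, and the last-slice decay of the
PG frame of `ℳ^(ext)` on `Σ_*` = the conclusion of Prop 6.4.3 (⇐ Prop 5.7.3) for `k ≤ k_* = k_small + 60` (v3, REFEREE #8
V4: NOT Theorem M3's `^*𝔇_{k_small+60}`).  Children in LEMMAS.md: Props 6.4.2, 6.4.3 (⇐ 5.7.3), 6.4.5, 6.4.7, 6.5.1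
(⇐ 6.3.2, 6.3.4), 6.5.2, 6.5.4, 6.6.2, Theorem M1.
[cite: KlainermanSzeftel2021, Proposition 6.4.4, TeX l.15442–15451] -/
def Prop644 {c : Constants} (K : LesConstants) (S : Setting c) (P : Ch5Side S) (C643 C644 : ℝ) : Prop := IDLWeak S → ∀ X : S.M, BA_B S X → BA_D S X →
  M1Concl K S X → (∀ k : ℕ, k ≤ kstar6 c → P.pg643 X k ≤ C643 * c.ε0) →
  ∀ k : ℕ, k ≤ kstar6 c - 8 → P.pg644 X k ≤ C644 * c.ε0

/-- **Edge node E-644: Theorem M4 ⇐ Prop 6.4.4 + Theorem M1 (item 2) + Prop 5.3.1** (v4, REFEREE #11 V5).  The printed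
bridge is ONE sentence, KS l.15440, verbatim: "Our goal in this chapter is to extend the results of Proposition [6.4.3] to
`ℳext`, i.e. to prove the following proposition which implies Theorem M4." — no proof.  Theorem M4 (l.6709–6715) bounds
`^(ext)𝔇_{k_small+40}`, whose definition (KS l.5826–5830, label `equation:defdecaynormsMext:chap3`, verbatim) has FIVE components:
`^(ext)𝔇_k := sup_{ℳext}(r u^{1+δ} + r²u^{1/2+δ})|𝔡^{≤k}Γ_g| + sup_{ℳext} r u^{1+δ}|𝔡^{≤k}Γ_b|
  + sup_{ℳext} r⁴u^{1/2+δ}(|𝔡^{≤k-1}∇_3 A| + |𝔡^{≤k-1}∇_3 B|) + sup_{ℳext} r²u^{1+δ}|𝔡^{≤k-1}∇_3Γ_g| + (∫_{Σ_*} u^{2+2δ}|𝔡^{≤k}Ȟ|²)^{1/2}`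
(`δ = δ_dec`).  The two displays of Prop 6.4.4, taken at every `k' ≤ k_small + 40 ≤ k_* − 8 = k_small + 52` (`𝔡^{≤k}`), cover
`Γ_g` (both weights), `Γ_b`, `∇_3Γ_g`, `∇_3 B` (and `tr X̌`); they do NOT contain (a) the `∇_3 A` component — its printed source is
Theorem M1 item 2 (l.6685–6687 — v4/v5 wrote l.6681–6684, REFEREE #14 L-2 — verbatim: "The quantity `A` verifies the estimate, for all `k ≤ k_small+100`,
`sup_{ℳext}( r²(2r+u)^{1+δ_extra}/log(1+u) + r³(2r+u)^{1/2+δ_extra} )( |𝔡^k A| + r|𝔡^{k-1}∇_3 A| ) ≲ ε0`"), and the weight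
domination `r⁴(2r+u)^{1/2+δ_extra} ≥ r⁴u^{1/2+δ_dec}` (`u ≥ 1`, `δ_extra > δ_dec`) is an analytic comparison, not bookkeeping
over this abstract carrier; nor (b) the `Σ_*`-flux of `Ȟ` — its printed source is Prop 5.3.1 (`Prop531`: `Γ_b` on `Σ_*`,
`k ≤ k_* − 7 = k_small + 73`; N.B. ch. 5's `Γ_b` is the REAL list l.9548 `{η, χ̲̂, ω̲̌, ξ̲, rβ̲, α̲, r⁻¹y̌, r⁻¹ž, r⁻¹b̌_*}` ∋ `η`,
while `Ȟ := H − (aq/|q|²)𝔍` with `H = η + i ⋆η` (l.1024, 4160, 6526) is the complexified outgoing-PG quantity, so the `Ȟ`-flux is the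
`η`-flux of (5.3.1) AFTER the frame/complexification identification, which is part of what this hypothesis assumes — REFEREE #14
N-1), as announced by the Remark l.5833–5836, verbatim: "The integral bootstrap assumption on `Σ_*` for
`Ȟ` will only be needed in the proof of Proposition [prop:constructionsecondframeinMext] and recovered in Proposition
[Prop.Flux-bb-vthb-eta-xib]", modulo the identification of `𝔡_*` / the frame adapted to `Σ_*` with `𝔡` / the outgoing PG frame
of `ℳ^(ext)` (cf. §5.7.5, l.13479–13489).  Typed as the named hypothesis that these three printed sources bound
`^(ext)𝔇_{k_small+40}` by `cM4·ε0`; ONLY the composition `thmM4_of_prop644` below is proved.  The integer ranges are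
kernel-checked separately (`kM4_le_kstar6_sub`, `kM4_le_kstar5_sub`).
[cite: KlainermanSzeftel2021, §6.4.3 "which implies Theorem M4" + eq. (3.3.x) defining ^(ext)𝔇_k + Theorem M1 (2) + Remark, TeX l.15440, 5826–5836, 6685–6687, 9548] -/
def Edge644 {c : Constants} (K : LesConstants) (S : Setting c) (P : Ch5Side S) (C531 C644 : ℝ) : Prop := ∀ X : S.M, BA_B S X → BA_D S X → M1Concl K S X →
  (∀ k : ℕ, k ≤ kstar5 c - 7 → P.flux531 X k ≤ (C531 * c.ε0) ^ 2) →
  (∀ k : ℕ, k ≤ kstar6 c - 8 → P.pg644 X k ≤ C644 * c.ε0) →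
  S.extD X (c.ksmall + 40) ≤ K.cM4 * c.ε0

/-- **Node KS7 (Theorem M5 scheme)** (KS ch. 7: Lemma 7.2.2 l.17322 and Lemma 7.4.3 l.17743 initialise the PG
structures of `ℳ^(int)` on `𝒯` and of `ℳ^(top)` on `{u = u_*}` from Theorem M4; §7.3 l.17354–17512 is the ordered
25-step transport scheme in `ℳ^(int)` (derivative levels `k_small+39`, `k_small+40`, … quoted in LEMMAS.md §1),
§7.5 the one in `ℳ^(top)`; both end with "we leave the details to the reader" (l.17510, l.17783) — kind `K`
(SKETCH) in the registry).  Inputs: BA, Theorem M4's conclusion, Theorem M1 (`𝔮`, `A`), Theorem M2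
(`^(int)𝔇[α̲] + ^(top)𝔇[α̲]`).
[cite: KlainermanSzeftel2021, §7.2–§7.5 (Lemmas 7.2.2, 7.4.3; scheme §7.3), TeX l.17322–17783] -/
def Ch7Scheme {c : Constants} (K : LesConstants) (S : Setting c) (C7 : ℝ) : Prop := IDLWeak S → ∀ X : S.M, BA_B S X → BA_D S X →
  M1Concl K S X → M2Concl K S X → S.extD X (c.ksmall + 40) ≤ K.cM4 * c.ε0 →
  S.intD X (c.ksmall + 20) + S.topD X (c.ksmall + 20) ≤ C7 * c.ε0


/-- Edge E-551 ⟶ M3 (bookkeeping, PROVED): `k_* − 12 = k_small + 68 ≥ k_small + 60`.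
[cite: KlainermanSzeftel2021, Remark after Proposition 5.5.1, TeX l.11873] -/
theorem thmM3fromM1M2_of_prop551 {c : Constants} {K : LesConstants} {S : Setting c} (h : Prop551 K S K.cM3) : ThmM3fromM1M2 K S := by
  intro hidl X hB hD h1 h2
  exact h hidl X hB hD h1 h2 (c.ksmall + 60) (by unfold kstar5; omega)

/-- Theorem M3 from the chapter-5 node and Theorems M1, M2 (composition with `Bootstrap.thmM3_of_M1_M2`).
[cite: KlainermanSzeftel2021, Remark after Proposition 5.5.1, TeX l.11873] -/
theorem thmM3_of_prop551 {c : Constants} {K : LesConstants} {S : Setting c} (h1 : ThmM1 K S) (h2 : ThmM2 K S) (h : Prop551 K S K.cM3) : ThmM3 K S :=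
  thmM3_of_M1_M2 h1 h2 (thmM3fromM1M2_of_prop551 h)

/-- Edge KS6.4.3 ⇐ KS5.7.3 (bookkeeping, PROVED, v3): the ch.-6 range `k ≤ k_* = k_small + 60` lies inside the ch.-5
range `k ≤ k_* − 15 = k_small + 65`, and the displays of 6.4.3 are dominated by those of 5.7.3 (`Edge643`).
[cite: KlainermanSzeftel2021, §6.1 restatement of Proposition 5.7.3, TeX l.15410–15428] -/
theorem prop643_of_prop573 {c : Constants} {K : LesConstants} {S : Setting c} {P : Ch5Side S} {C : ℝ} (he : Edge643 S P) (h : Prop573 K S P C) : Prop643 K S P C := by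
  intro hidl X hB hD h1 h2 h551 k hk
  exact (he X k).trans (h hidl X hB hD h1 h2 h551 k (by unfold kstar5; unfold kstar6 at hk; omega))

/-- Range bookkeeping for E-644 (PROVED): Theorem M4's level `k_small + 40` lies inside Prop 6.4.4's range
`k ≤ k_* − 8 = k_small + 52` (ch.-6 `k_*`).
[cite: KlainermanSzeftel2021, Theorem M4 vs Propositions 6.4.4 / 5.3.1 (derivative ranges), TeX l.6709–6715, 15442–15447, 10644–10647] -/
theorem kM4_le_kstar6_sub {c : Constants} : c.ksmall + 40 ≤ kstar6 c - 8 := by unfold kstar6; omega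

/-- Range bookkeeping for E-644 (PROVED): `k_small + 40` lies inside Prop 5.3.1's range `k ≤ k_* − 7 = k_small + 73`
(ch.-5 `k_*`).
[cite: KlainermanSzeftel2021, Theorem M4 vs Propositions 6.4.4 / 5.3.1 (derivative ranges), TeX l.6709–6715, 15442–15447, 10644–10647] -/
theorem kM4_le_kstar5_sub {c : Constants} : c.ksmall + 40 ≤ kstar5 c - 7 := by unfold kstar5; omega

/-- Edge E-644 ⟶ M4 (composition, PROVED; v4 shape answering REFEREE #11 V5, on top of the v3 shape answering #8 V4):
Theorem M4 from Theorems M1, M2, Prop 5.5.1, Prop 5.7.3, `Edge643` (⇒ Prop 6.4.3), Prop 5.3.1, Prop 6.4.4 and the named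
norm-assembly hypothesis `Edge644`.  The inputs of Prop 6.4.4 are Theorem M1 (KS l.13508, Ref 2 l.13756), the bootstrap
assumptions and Prop 6.4.3's conclusion (from Prop 5.7.3, whose own inputs are M1, M2 on `Σ_*` and Prop 5.5.1 for
`k ≤ k_* − 12`); Theorem M3 itself is NOT a hypothesis (its content enters only through `Prop551`, exactly as in KS ch. 5 →
§5.7 → §6.4); the full norm `^(ext)𝔇_{k_small+40}` is reached only through `Edge644` (Prop 6.4.4's two displays + M1's
`A`-jet + Prop 5.3.1's `Σ_*`-flux).
[cite: KlainermanSzeftel2021, §6.4.3 "which implies Theorem M4", TeX l.15440] -/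
theorem thmM4_of_prop644 {c : Constants} {K : LesConstants} {S : Setting c} {P : Ch5Side S} {C573 C531 C644 : ℝ} (h1 : ThmM1 K S) (h2 : ThmM2 K S)
    (h551 : Prop551 K S K.cM3) (h573 : Prop573 K S P C573) (he : Edge643 S P) (h531 : Prop531 K S P C531)
    (h : Prop644 K S P C573 C644) (he644 : Edge644 K S P C531 C644) : ThmM4 K S := by
  intro hidl X hB hD
  have hM1 : M1Concl K S X := h1 hidl X hB hD
  have hM2 : M2Concl K S X := h2 hidl X hB hD
  have h5 : ∀ k : ℕ, k ≤ kstar5 c - 12 → S.starD X k ≤ K.cM3 * c.ε0 :=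
    fun k hk => h551 hidl X hB hD hM1 hM2 k hk
  have h643 : ∀ k : ℕ, k ≤ kstar6 c → P.pg643 X k ≤ C573 * c.ε0 :=
    fun k hk => prop643_of_prop573 he h573 hidl X hB hD hM1 hM2 h5 k hk
  have hflux : ∀ k : ℕ, k ≤ kstar5 c - 7 → P.flux531 X k ≤ (C531 * c.ε0) ^ 2 :=
    fun k hk => h531 hidl X hB hD hM1 hM2 k hk
  have h644 : ∀ k : ℕ, k ≤ kstar6 c - 8 → P.pg644 X k ≤ C644 * c.ε0 :=
    fun k hk => h hidl X hB hD hM1 h643 k hk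
  exact he644 X hB hD hM1 hflux h644

/-- Edge KS7 ⟶ M5 (PROVED composition). [cite: KlainermanSzeftel2021, §7.1 proof plan of Theorem M5, TeX l.17300–17354] -/
theorem thmM5_of_ch7 {c : Constants} {K : LesConstants} {S : Setting c} (h1 : ThmM1 K S) (h2 : ThmM2 K S) (h4 : ThmM4 K S) (h : Ch7Scheme K S K.cM5) :
    ThmM5 K S := by
  intro hidl X hB hD
  exact h hidl X hB hD (h1 hidl X hB hD) (h2 hidl X hB hD) (h4 hidl X hB hD)

end Layer2

/-! ## Cross-paper edges E-M1, E-M2: [KS] Theorems M1, M2 ⇐ [GKS] Theorems 11.7.1, 12.4.4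

[KS] l.7639: "Theorems M1 and M2 are proved in [GKS]".  [GKS] proves Thm 11.7.1 (l.22381–22394, = its intro
Thm 1.5.2) and Thm 12.4.4 (l.24277–24288) under ITS OWN hypotheses: the assumptions of [GKS] §3.4–3.6 on the
Ricci/metric coefficients in the global frame, which [GKS] l.1793–1794 says follow "by interpolation" from the
KS bootstrap assumptions (3.5.1)–(3.5.2) and the global frame of KS §3.6.3.  The translation is NOT an identity
(GAPS.md E1: KS supplies the u-decay exponent `δ_dec − 2δ_0`, GKS assumes `δ_dec`; `τ` vs `u, u̲`; derivative
ranges `k ≤ k_L − 10` vs `k ≤ k_small + 100`; GAPS.md G-2/E2: the `^(int)𝔇 + ^(top)𝔇 [α̲]` clause of M2 has no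
counterpart in Thm 12.4.4; E-M2(ii): Thm 12.4.4 bounds `∫_{Σ_*(≥τ)} |𝔡^kα̲|² ≲ ε0² τ^{-2-2δ_dec}` whereas M2 wants
`∫_{Σ_*} u^{2+2δ_dec} |𝔡^kα̲|² ≲ ε0²` — with the SAME exponent the dyadic conversion diverges logarithmically).
Each disputed translation step is therefore a NAMED HYPOTHESIS NODE below, and only the compositions are proved. -/

section GKSEdges

/-- The [GKS]-side statements about a KS spacetime `X : S.M`, kept abstract (typed verbatim by the day-2 owners
of nodes GKS11.7.1 / GKS12.4.4 in LEMMAS.md §4):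
* `hyp1171 X`  — the hypotheses of [GKS] Thm 11.7.1 for `X` (the assumptions of [GKS] §§3.4–3.6 with `ε`);
* `concl1171 X δ` — its three conclusions (11.7.1)–(11.7.3) with `δ_extra = δ` (l.22384–22393);
* `hyp1244 X`  — the additional `Σ_*` hypotheses of [GKS] Thm 12.4.4 (l.24279–24283: `Σ_*` assumptions of
  §3.x and the flux bound for `∇_3 𝔡^k 𝔮` "established in Theorem M1");
* `concl1244 X` — its conclusion `∫_{Σ_*(≥τ)} |𝔡^kα̲|² ≲ ε0² τ^{-2-2δ_dec}`, `k ≤ k_L − 7` (l.24285–24287).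
[cite: GiorgiKlainermanSzeftel2022, Theorems 11.7.1 and 12.4.4 (print 12.4.5), TeX l.22381–22394, 24277–24288] -/
structure GKSSide {c : Constants} (S : Setting c) where
  hyp1171 : S.M → Prop
  concl1171 : S.M → ℝ → Prop
  hyp1244 : S.M → Prop
  concl1244 : S.M → Prop


/-- **E-M1(a)** ([GKS] l.1793–1794 "by interpolation"; GAPS.md E1): the KS bootstrap assumptions imply the
hypotheses of [GKS] Thm 11.7.1.  DISPUTED exponent bookkeeping — hypothesis node, not proved.
[cite: GiorgiKlainermanSzeftel2022, §1.5 "by interpolation", TeX l.1793–1794] -/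
def EdgeM1hyp {c : Constants} (S : Setting c) (G : GKSSide S) : Prop := ∀ X : S.M, BA_B S X → BA_D S X → G.hyp1171 X

/-- **Node GKS11.7.1** as an implication over the abstract statements (∃ δ_extra > δ_dec).
[cite: GiorgiKlainermanSzeftel2022, Theorem 11.7.1 (= Theorem M1 of KS; print Thm 11.7.1, HAL p.527), TeX l.22381–22394] -/
def ThmGKS1171 {c : Constants} (S : Setting c) (G : GKSSide S) : Prop := IDLWeak S → ∀ X : S.M, G.hyp1171 X → ∃ δ : ℝ, c.δdec < δ ∧ G.concl1171 X δ

/-- **E-M1(b)**: the conclusions of [GKS] Thm 11.7.1 (in `τ`, `k ≤ k_L − 10`) give the three displays of KS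
Theorem M1 (in `u`, `u̲`, `k ≤ k_small + 100`) with the same `δ_extra`.  Hypothesis node.
[cite: GiorgiKlainermanSzeftel2022, Theorem 11.7.1 conclusions (11.7.1)–(11.7.3), TeX l.22384–22393] -/
def EdgeM1concl {c : Constants} (K : LesConstants) (S : Setting c) (G : GKSSide S) : Prop := ∀ (X : S.M) (δ : ℝ), G.concl1171 X δ →
  S.m1Sup X δ ≤ K.cM1 * c.ε0 ∧ S.m1Flux X δ ≤ (K.cM1 * c.ε0) ^ 2 ∧ S.m1A X δ ≤ K.cM1 * c.ε0

/-- **E-M2(0)**: the `Σ_*` hypotheses of [GKS] Thm 12.4.4 from the KS bootstrap assumptions and the M1 flux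
bound (l.24281–24283 "as established in Theorem M1"), AND the standing gauge hypothesis (12.1.3) of [GKS] ch. 12
(`Ξ ∈ r^{-2}Γ_g`, `Ȟ̲ ∈ r^{-1}Γ_g`, l.22608–22612), which the audit cell records as supplied by neither KS frame.  Hypothesis node.
[cite: GiorgiKlainermanSzeftel2022, Theorem 12.4.4 hypotheses and (12.1.3), TeX l.24279–24283, 22608–22612] -/
def EdgeM2hyp {c : Constants} (K : LesConstants) (S : Setting c) (G : GKSSide S) : Prop := ∀ X : S.M, BA_B S X → BA_D S X → M1Concl K S X → G.hyp1244 X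

/-- **Node GKS12.4.4** over the abstract statements (print: Theorem 12.4.5, HAL p.585).
[cite: GiorgiKlainermanSzeftel2022, Theorem 12.4.4 (= Theorem M2 of KS), TeX l.24277–24288] -/
def ThmGKS1244 {c : Constants} (S : Setting c) (G : GKSSide S) : Prop := IDLWeak S → ∀ X : S.M, G.hyp1171 X → G.hyp1244 X → G.concl1244 X

/-- **E-M2(ii)** (exponent conversion, DISPUTED — see the section docstring): the tail bound of Thm 12.4.4
gives KS's weighted flux `max_k ∫_{Σ_*} u^{2+2δ_dec}|𝔡^kα̲|² ≲ ε0²`.  Hypothesis node.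
[cite: GiorgiKlainermanSzeftel2022, Theorem 12.4.4 conclusion vs KS Theorem M2, TeX l.24285–24287] -/
def EdgeM2flux {c : Constants} (K : LesConstants) (S : Setting c) (G : GKSSide S) : Prop := ∀ X : S.M, G.concl1244 X → S.m2Flux X ≤ (K.cM2 * c.ε0) ^ 2

/-- **E-M2(i)** (GAPS.md G-2 / E2: UNSOURCED in [GKS]): the interior/top clause
`^(int)𝔇_{k_small+80}[α̲] + ^(top)𝔇_{k_small+80}[α̲] ≲ ε0` of KS Theorem M2.  Hypothesis node recording exactly
what a proof would have to supply (inputs it may use: BA, Theorem M1, the `Σ_*` flux of Thm 12.4.4).  v8 (print status; cell GAPS.md G-2/E2 RESOLVED IN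
PRINT, lead block 16 (3) / REFEREE #26–#27): the refereed statement of Theorem M2 (Pure Appl. Math. Q. 19 (2023); authors' accepted
manuscript HAL hal-04280491, p. 158 L2–9) consists of the `Σ_*` flux ONLY — this clause is absent in print, and the `A̲` decay it named in
v1 is proved there as Prop 7.3.1 (p. 427) / Prop 7.6.1 (p. 447).  The node is KEPT: `Bootstrap.ThmM2` types the v1 statement (with the
clause) and `thmM2_of_gks` consumes this node; against the printed Theorem M2 the clause, and with it this hypothesis, is not needed.
[cite: KlainermanSzeftel2021, Theorem M2 interior/top clause, TeX l.6691–6697] -/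
def EdgeM2int {c : Constants} (K : LesConstants) (S : Setting c) (G : GKSSide S) : Prop := IDLWeak S → ∀ X : S.M, BA_B S X → BA_D S X → M1Concl K S X → G.concl1244 X →
  S.m2Dec X ≤ K.cM2 * c.ε0


/-- KS Theorem M1 from [GKS] Thm 11.7.1 and the two translation nodes (PROVED composition).
[cite: KlainermanSzeftel2021, "Theorems M1 and M2 are proved in [GKS]", TeX l.7639] -/
theorem thmM1_of_gks {c : Constants} {K : LesConstants} {S : Setting c} {G : GKSSide S} (ha : EdgeM1hyp S G) (h : ThmGKS1171 S G) (hb : EdgeM1concl K S G) :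
    ThmM1 K S := by
  intro hidl X hB hD
  obtain ⟨δ, hδ, hc⟩ := h hidl X (ha X hB hD)
  exact ⟨δ, hδ, hb X δ hc⟩

/-- KS Theorem M2 from [GKS] Thm 12.4.4, Theorem M1 and the three translation nodes (PROVED composition).
[cite: KlainermanSzeftel2021, "Theorems M1 and M2 are proved in [GKS]", TeX l.7639] -/
theorem thmM2_of_gks {c : Constants} {K : LesConstants} {S : Setting c} {G : GKSSide S} (ha : EdgeM1hyp S G) (h1 : ThmM1 K S) (h0 : EdgeM2hyp K S G)
    (h : ThmGKS1244 S G) (hf : EdgeM2flux K S G) (hi : EdgeM2int K S G) : ThmM2 K S := by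
  intro hidl X hB hD
  have hM1 : M1Concl K S X := h1 hidl X hB hD
  have hc : G.concl1244 X := h hidl X (ha X hB hD) (h0 X hB hD hM1)
  exact ⟨hi hidl X hB hD hM1 hc, hf X hc⟩

end GKSEdges

end Literature.Geometry.Lorentzian.KlainermanSzeftel2021.Dag

/-! ---------------------------------------------------------------------------------------------------------------
The remaining section is the cell's v1 material kept name-stable (the cell's `IterationAbsorption` / `IterationStep`
modules prove the absorptions of `Cor9421` / `KS_Cor_9_4_21_of_GKS_13_6_3` against these names).  It is independent of
`Bootstrap`; the bridge `Ch9Iteration` ↔ `Bootstrap.Setting.ptNorm/iter` (`IterBase/IterStep/IterTop`) is not typed here.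
---------------------------------------------------------------------------------------------------------------- -/

namespace Literature.Geometry.Lorentzian.KlainermanSzeftel2021


/-- Theorem M8 machinery (KS §9.4.7–9.4.8) as an abstract iteration record: `S J`, `R J` = `𝔖_J`, `ℜ_J`
(KS Def 9.4.9 / (9.4.26)–(9.4.31), l.24380–24440: weighted top-order Ricci and curvature energies in the PT frame),
their regional parts, `L J` = `L_*(J)` (KS (9.4.34), l.24452), `epsJ J` = `ε_J` ([GKS] (13.6.4)); the constants
`ε0, ε, r0, a, δB, kLarge`.  Nothing is asserted over it; the node shapes below are hypotheses.
[cite: KlainermanSzeftel2021, Definition 9.4.9 and (9.4.26)–(9.4.34), TeX l.24380–24452] -/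
structure Ch9Iteration where
  ε0 : ℝ
  ε : ℝ
  r0 : ℝ
  a : ℝ
  δB : ℝ
  kLarge : ℕ
  S : ℕ → ℝ
  R : ℕ → ℝ
  Sstar : ℕ → ℝ
  Sext : ℕ → ℝ
  Sint : ℕ → ℝ
  Stop : ℕ → ℝ
  StopFar : ℕ → ℝ
  Rstar : ℕ → ℝ
  Rext : ℕ → ℝ
  Rint : ℕ → ℝ
  Rtop : ℕ → ℝ
  L : ℕ → ℝ
  epsJ : ℕ → ℝ

namespace Ch9Iteration

/-- `k_small = ⌊k_large/2⌋ + 1` for this record. [cite: KlainermanSzeftel2021, eq. (3.4.6), TeX l.6113] -/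
def kS (I : Ch9Iteration) : ℕ := kSmall I.kLarge

/-- `k_L = k_large + 7` for Part III (the proof of Theorem M8).  GKS l.1795, introduction §1.5: "For the proof of the
curvature estimates of Theorem M8 …, we choose $\kl=k_{large}+7$" (journal Pure Appl. Math. Q. 20 (2024), PDF p. 45 L18: "we choose
kL = klarge + 7"); restated with the range `k_small − 1 ≤ J ≤ k_large + 6` in the introduction's Theorem M8, l.1860.  v9 locator fix
(DIVERGENCE DV-f3-11 nit): v1–v8 cited "GKS l.25890", which is the bootstrap display (13.6.2) `𝔖_k + ℜ_k ≤ ε, k ≤ k_L` of §13.6.1;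
Part III itself never names `k_large`.
[cite: GiorgiKlainermanSzeftel2022, §1.5 choice of k_L for Part III / Theorem M8, TeX l.1795] -/
def kL (I : Ch9Iteration) : ℕ := I.kLarge + 7

/-- KS (9.4.32), l.24443–24445: bootstrap **BA-PT** `𝔖_{k_large+7} + ℜ_{k_large+7} ≤ ε`.  v6: = (9.4.20), l.24317–24319 ("To prove
Theorem [9.4.10], we make the following bootstrap assumptions"), assumed "throughout" (l.24442) §§9.4.4–9.9 and "improved" to `≲ ε₀`
at l.24732–24740; its INITIATION (smallness of the PT norms on an initial region of the spacetime of Theorem M7) and the continuity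
argument CLOSING it are not in print — cell Q3 (registry node BA-PT, kind I; typed leaf `Bootstrap.BAPTonExtension`).
[cite: KlainermanSzeftel2021, eq. (9.4.32), TeX l.24443–24445] -/
def BAch9 (I : Ch9Iteration) : Prop := I.S (I.kLarge + 7) + I.R (I.kLarge + 7) ≤ I.ε

/-- KS Lemma 9.4.13 / (9.4.22), l.24355–24360: `𝔖_{k_small−1} + ℜ_{k_small−1} ≲ ε₀`.  v6 (cell GAPS.md K20b): this is the
STATEMENT (global norms of §9.4.1).  The §9.4.8 display `L_*(k_small−1) ≲ ε₀` "in view of (9.4.22)" (l.24684–24687, registry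
node KS9.4.8-L0) — a flux through the single slice `{u = u_*'}` — is fed not by this statement but by the weighted sup-decay display
inside its PROOF (item 5, l.24414–24419: `sup_{ℳext ∪ ℳtop'(r ≥ r₀)}{r²u^{1/2+δ_dec}|𝔡^{≤k}Γ_g'| + r u^{1+δ_dec}|𝔡^{≤k}Γ_b'|}
+ sup_{ℳtop'(r ≤ r₀) ∪ ℳint'} u̲^{1/2+δ_dec}{|𝔡^{≤k}Γ_g'| + |𝔡^{≤k}Γ_b'|} ≲ ε₀`; registry node KS9.4.13-sup, kind K), cf. the tree's
`SliceChoice.L0_of_sliceDecay` (hypothesis `hdec`).  v7 (cell GAPS.md K20b′/K20b″ = f3-g4 + tree `SupToFluxExponents`, K20b‴ = lead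
block 9, referee V8): the proof's closing sentence l.24420–24425 ("The weights in r, u and u̲ are enough to take care of the spacetime
integrations in the global norms … and we finally obtain (9.4.22)", no computation) is registry node E-9413 (kind E, norm assembly).
Size `ε` of `ℜ_{k_small−1}` is outright under BA-PT ((9.4.20) l.24317–24319); the content is the improvement to `ε₀`, and the `(A,B)`
`r^{3+δ_B}`-bulk of `^(ext)ℜ_{k_small−1}` (l.23912–23915) at size `ε₀` needs pointwise r-rates `> 3 + δ_B/2` with `u^{−1/2−δ_X}`,
`δ_B < 2δ_X`: at Theorem M7's rate 3 (decay norm l.5826–5831) the far zone carries `r_*^{δ_B}` and the near zone `√u ≤ r ≤ u` carries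
`u_*^{δ_B−2δ_dec}` — non-uniform in `u_*` precisely because of the printed `δ_B > 2δ_dec` (l.6076–6081).  A-half ⇐ Theorem M1 item 2
(l.6684–6687) plus the UNPRINTED ordering `δ_B < 2δ_extra` (= `3δ_dec − 2δ` at GKS's value, window nonempty iff `δ < δ_dec/2`);
B-half = registry node KS9.4.13-Brate (an `ε₀`-size rate `> 3 + δ_B/2` for `𝔡^{≤k_small−1}B` on `ℳext` of the extension;
v7–v13 kind U "not located"; v14 kind E = DERIVABLE-NOT-PRINTED — printed by NO statement of [KS]/[GKS]/[GCM1]/[GCM2]/[Shen]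
(Theorem M7 exports rate 3 for `B`), but assembled from PRINTED statements of [KS]: the refereed [J] Prop 6.5.4 two-branch profile
`|𝔡^{≤k_*−6}B| ≲ ε₀ min{r^{−7/2−δ_dec}, r^{−3−δ'}u^{−1/2−δ_dec}}` on `ℳext` (HAL hal-04280491 p0407 L5–13; v1 l.16639 prints the second
branch only), Prop 5.7.3 (`Σ_*` foot values, l.12781–12800) and the curvature item (2.2.21) of Prop 2.2.3 (= [GCM1] Prop 3.3,
`λ⁻¹β' = β + (3/2)(fρ + *f *ρ) + ½α·f̲ + l.o.t.`, no derivative of the coefficients), by an UNPRINTED re-run of Theorem M7 Step 18's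
printed transfer sentence (l.23045–23053 = [J] p0592 L44–53, printed as applied to the Dec weights only) on the weight
`r^{7/2+δ_dec}`, the PG → PT passage being items 1, 2, 5 of this lemma's own proof; residual unprinted = the CHOICE
`δ_B ∈ (2δ_dec, T)`, `T = 2δ_dec + (δ_extra − δ_dec)/(1 + 2δ_dec)` (l.6078 = [J] (3.4.1) permits, does not make it) + the applications
(cell bookkeeping `KlainermanSzeftel2021.FrameTransferCount`, a PRICE, never a discharge); closers R1 / V-BA / V-J654, V-J654 the
cheapest; class E OPEN-PRICED unchanged; registry children KS6.5.4, KS5.7.3, KS8.5-S18, KS2.2.3).  This statement is consumed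
as the iteration base by Remark 9.4.14 (l.24467–24473) and, through KS9.4.13-sup, by KS9.4.8-L0.  Class E precise gap; no
declaration changed.
[cite: KlainermanSzeftel2021, Lemma 9.4.13, TeX l.24355–24360] -/
def Lemma9413 (I : Ch9Iteration) (C : ℝ) : Prop := I.S (I.kS - 1) + I.R (I.kS - 1) ≤ C * I.ε0

/-- KS (9.4.33), l.24448–24450: iteration assumption `𝔖_J + ℜ_J ≲ ε₀ + L_*(J)`
(made for `k_small − 1 ≤ J ≤ k_large + 5`). [cite: KlainermanSzeftel2021, eq. (9.4.33), TeX l.24448–24450] -/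
def IterKS (I : Ch9Iteration) (C : ℝ) (J : ℕ) : Prop := I.S J + I.R J ≤ C * (I.ε0 + I.L J)

/-- KS Thm 9.4.15 "Control of Curvature", v1 FORM A, l.24481–24488: for
`k_small − 1 ≤ J ≤ k_large + 6`, under (9.4.33) for `J`,
`ℜ_{J+1} ≲ r₀^{-δ_B}(𝔖^{top,≥r₀}_{J+1} + 𝔖^{ext}_{J+1}) + r₀^{10}(ℜ_J + 𝔖_J) + ε₀`,
constant independent of `r₀` ("will be proved in [KS:Kerr-B]", Rem 9.4.16).  v8 (print status; cell GAPS.md G-1 FORM half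
RESOLVED IN PRINT, lead block 16 (3) / REFEREE #26–#27): the refereed [KS] (HAL hal-04280491) Thm 9.4.15, p. 627 L13–61, states FORM B′ —
the shape of `Thm1363_formB` below / [GKS] (13.6.8), with the `√|a| r₀^{3+δ_B/2} 𝔊_{J+1}` term and without `r₀^{10}(ℜ_J + 𝔖_J)` — for
`k_small − 1 ≤ J ≤ k_large + 6`, and derives it (§9.6.2, p. 653) from Thm 9.6.7 "J ≤ k_large + 6" = "Theorem 13.6.3 in [28]", whose
printed range is `k_L/2 ≤ J ≤ k_L − 1`: the J-RANGE half of G-1 remains (registry node KS9.4.15 keeps kind U for it).  FORM A is the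
arXiv-v1 text only; this def is kept as its transcription.
[cite: KlainermanSzeftel2021, Theorem 9.4.15 (arXiv v1 form), TeX l.24481–24490] -/
def Thm9415_formA (I : Ch9Iteration) (C Citer : ℝ) : Prop :=
  ∀ J, I.kS - 1 ≤ J → J ≤ I.kLarge + 6 → I.IterKS Citer J →
    I.R (J + 1) ≤ C * (I.r0 ^ (-I.δB) * (I.StopFar (J + 1) + I.Sext (J + 1))
      + I.r0 ^ (10 : ℝ) * (I.R J + I.S J) + I.ε0)

/-- GKS Thm 13.6.3 + Remark (13.6.8), FORM B′, l.25953–25983: for `k_L/2 ≤ J ≤ k_L − 1`, under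
(13.6.1)–(13.6.5) (data, bootstrap, low-derivative decay up to `k_L/2`, `𝔖_J + ℜ_J ≲ ε_J`,
`Ξ = 0`, `Ȟ̲ = 0` for `r ≥ r₀ + 1` — opaque here), the bound (13.6.8) with the `√|a| r₀^{3+δ/2} 𝔖_{J+1}`
and sublinear terms.  Extra hypotheses kept opaque as `H1363`.  v9 (DIVERGENCE DV-f3-11 = f3-g9, tree `GiorgiKlainermanSzeftel2022/JFloorUses` §1;
lead ruling GAPS.md block 18 ADDENDUM 2 (A12); REFEREE #33): the printed floor "k_L/2 ≤ J" (l.25955; PAMQ PDF p. 627 L64) is now typed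
EXACTLY for integer `J` as `I.kL ≤ 2 * J` (⟺ `k_small + 3 ≤ J` for both parities of `k_large` = the lower end `⌊k_large/2⌋ + 4` of
`JunctionLevels.gksRange`; `JFloorUses.OnCarrier.printFloor_iff`).  v1–v8 typed it with ℕ-division, `I.kL / 2 ≤ J` ⟺
`k_small + 2 + (k_large mod 2) ≤ J`, which for EVEN `k_large` posited GKS's conclusion at one level, `J = k_small + 2`, that the printed
theorem does not cover (`JFloorUses.natDiv_admits_extra_level`; odd `k_large`: the readings coincide).  Binder type only: no node, edge
or constant changed; the one code-level consumer, `iter_step_of_GKS_13_6_8` (`IterationStep` v2), takes the printed floor as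
`hJ1 : I.kL ≤ 2 * J`; KS's uncovered bottom steps are 4 in print for both parities (`JunctionLevels.uncovered_card`).
[cite: GiorgiKlainermanSzeftel2022, Theorem 13.6.3 and Remark 13.6.4 / (13.6.8) (print (13.6.9), HAL p.627), TeX l.25953–25983] -/
def Thm1363_formB (I : Ch9Iteration) (H1363 : ℕ → Prop) (C : ℝ) : Prop :=
  ∀ J, I.kL ≤ 2 * J → J ≤ I.kL - 1 → H1363 J → I.S J + I.R J ≤ C * I.epsJ J →
    I.R (J + 1) ≤ C * (I.r0 ^ (21 + I.δB) * I.epsJ J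
      + I.r0 ^ ((21 + I.δB) / 2) * (Real.sqrt (I.S (J + 1)) * Real.sqrt (I.epsJ J) + I.ε0)
      + Real.sqrt |I.a| * I.r0 ^ (3 + I.δB / 2) * I.S (J + 1)
      + I.r0 ^ (-I.δB / 2) * I.Sext (J + 1)
      + I.r0 ^ ((39 : ℝ) / 8 + I.δB / 2) * I.S (J + 1) ^ ((3 : ℝ) / 4)
          * (I.ε0 + Real.sqrt (I.epsJ J) * Real.sqrt (I.S (J + 1))) ^ ((1 : ℝ) / 4)
      + I.r0 ^ ((39 : ℝ) / 7 + 4 * I.δB / 7) * I.S (J + 1) ^ ((6 : ℝ) / 7)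
          * I.epsJ J ^ ((1 : ℝ) / 7))

/-- KS Props 9.4.17–9.4.20, l.24496–24542 (conclusions only; hypotheses = (9.4.33) for `J`).
[cite: KlainermanSzeftel2021, Propositions 9.4.17–9.4.20, TeX l.24496–24542] -/
def Props9417to9420 (I : Ch9Iteration) (C : ℝ) : Prop :=
  ∀ J, I.kS - 1 ≤ J → J ≤ I.kLarge + 6 →
    I.Sstar (J + 1) ≤ C * (I.Rstar (J + 1) + I.ε0) ∧
    I.Sext (J + 1) ≤ C * (I.Sstar (J + 1) + I.Rext (J + 1) + I.ε0) ∧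
    I.Sint (J + 1) ≤ C * (I.Sext (J + 1) + I.Rint (J + 1) + I.ε0) ∧
    I.Stop (J + 1) ≤ C * (I.ε0 + I.L (J + 1) + I.Rtop (J + 1))

/-- KS Cor 9.4.21, l.24549–24564: (1) `ℜ_{J+1} + 𝔖^*_{J+1} ≲ ε₀ + r₀^{-δ_B} L_*(J+1) + r₀^{10}(ℜ_J+𝔖_J)`;
(2) `𝔖_{J+1} ≲ ε₀ + L_*(J+1) + r₀^{10}(ℜ_J + 𝔖_J)` — all that §9.4.8 consumes.
[cite: KlainermanSzeftel2021, Corollary 9.4.21, TeX l.24549–24564] -/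
def Cor9421 (I : Ch9Iteration) (C Citer : ℝ) : Prop :=
  ∀ J, I.kS - 1 ≤ J → J ≤ I.kLarge + 6 → I.IterKS Citer J →
    I.R (J + 1) + I.Sstar (J + 1) ≤ C * (I.ε0 + I.r0 ^ (-I.δB) * I.L (J + 1)
        + I.r0 ^ (10 : ℝ) * (I.R J + I.S J)) ∧
    I.S (J + 1) ≤ C * (I.ε0 + I.L (J + 1) + I.r0 ^ (10 : ℝ) * (I.R J + I.S J))

/-- E-M8 (adv1's name): the DIVERGENT edge, to be PROVED or localised as a gap by its claimant:
GKS FORM B′ ∧ KS Props 9.4.17–9.4.20 ∧ `r₀` large ∧ `|a| r₀^{6+δ_B}` small ∧ `ε₀` small ⇒ KS Cor 9.4.21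
on the GKS range `k_L/2 ≤ J`.  The range `k_small − 1 ≤ J < k_L/2` is NOT covered (cell LEMMAS.md FR-8).  v9: the floor is typed
`I.kL ≤ 2 * J` (exact integer reading of print, DIVERGENCE DV-f3-11 — see `Thm1363_formB`); the uncovered KS steps are
`J ∈ {k_small − 1, k_small, k_small + 1, k_small + 2}` for both parities of `k_large`.
[cite: KlainermanSzeftel2021, Corollary 9.4.21 via Theorem 9.4.15 "proved in [GKS]", TeX l.24481–24600] -/
def KS_Cor_9_4_21_of_GKS_13_6_3 (I : Ch9Iteration) (H1363 : ℕ → Prop) (Cgks Cks C Citer asmall : ℝ) : Prop :=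
  I.Thm1363_formB H1363 Cgks → I.Props9417to9420 Cks →
    Real.sqrt |I.a| * I.r0 ^ (3 + I.δB / 2) * Cgks ≤ asmall →
    ∀ J, I.kL ≤ 2 * J → J ≤ I.kLarge + 6 → (∀ J', J' ≤ J → H1363 J') → I.IterKS Citer J →
      I.R (J + 1) + I.Sstar (J + 1) ≤ C * (I.ε0 + I.r0 ^ (-I.δB) * I.L (J + 1)
          + I.r0 ^ (10 : ℝ) * (I.R J + I.S J)) ∧
      I.S (J + 1) ≤ C * (I.ε0 + I.L (J + 1) + I.r0 ^ (10 : ℝ) * (I.R J + I.S J))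

/-- KS Lemma 9.4.22, l.24634–24639: interpolation
`L_*(k) ≲ L_*(k_small − 1)^{θ_k} L_*(k_large + 7)^{1−θ_k}` for `k_small − 1 ≤ k ≤ k_large + 7`.
REFEREE #5 note: the TeX gives `θ_k` EXPLICITLY, `θ_k = (k_large + 7 − k)/(k_large + 7 − (k_small − 1))`; the abstract
`θ` with `0 ≤ θ_k ≤ 1` below is a weaker hypothesis.  v5: the kernel certificate of node KS9.4.10
(`IterationClosure.thm9410_explicit`, which imports this file) consumes ONLY the instance `k = k_large + 6` and needs
`0 < θ_{k_large+6} < 1` as separate hypotheses (KS: `θ_{k_large+6} = 1/N`, `N = k_large + 7 − (k_small − 1)`, l.24682).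
[cite: KlainermanSzeftel2021, Lemma 9.4.22, TeX l.24634–24639] -/
def Lemma9422 (I : Ch9Iteration) (C : ℝ) (θ : ℕ → ℝ) : Prop :=
  ∀ k, I.kS - 1 ≤ k → k ≤ I.kLarge + 7 → 0 ≤ θ k ∧ θ k ≤ 1 ∧
    I.L k ≤ C * I.L (I.kS - 1) ^ θ k * I.L (I.kLarge + 7) ^ (1 - θ k)

/-- KS Thm 9.4.10 "Main PT-Theorem", l.24053–24064: `𝔖_k + ℜ_k ≲ ε₀` for all `k ≤ k_large + 7`
(proof §9.4.8, l.24606–24747, from Lemma 9.4.13, Cor 9.4.21, Lemma 9.4.22 by induction on `J`).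
REFEREE #5 note (LEMMAS.md §1): its initial-data hypothesis in the TeX is the WEAK variant `𝔍_{k_large+10} ≤ ε₀`,
`^(ext)𝔍_3 ≤ ε₀²` (KS Remark 3.4.7 / (3.4.10)), i.e. `Bootstrap.IDLWeak`, not the Main Theorem's `𝔎 ≤ ε₀²`.
v10 consumer note (registry K-node KS9.4.3-S3 + U-leaf KS9.4.3-S3-in; cell finding E28, GAPS.md f3 block 21 / lead block 23 (4); kernel
count `Literature.Geometry.Lorentzian.GiorgiKlainermanSzeftel2022.ExteriorWeightLedger`): in the proof of Theorem M8 this `L²`-based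
conclusion is consumed by §9.4.3 Step 3 = display (9.4.17), l.24131–24139 ("In view of the control of the PT frames provided by
Theorem 9.4.10, together with Sobolev and the trace theorem, we obtain, for k ≤ k_large+4, …": on `ℳext` the sup bounds
`r²|𝔡^{≤k}Γ_g| + r|𝔡^{≤k}Γ_b| + r^{7/2+δ_B/2}(|𝔡^{≤k}A| + |𝔡^{≤k}B|) ≲ ε₀`, Def 9.2.4 l.23387–23410), qualified by Remark 9.4.11
(l.24141–24147: `tr X̲̌`, `Ξ̲` a priori at `r^{2−δ_B/2}`, `r^{1−δ_B/2}`, recovered by transport from `Σ_*`) and feeding Step 6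
(l.24232–24299, the improvement of BA-B, whose `^(ext)𝔅_k` (3.3.13) l.5811–5815 carries `r^{7/2+δ_B/2}(|𝔡^{≤k}A| + |𝔡^{≤k}B|)`).
By the cell's scaling count (`supOfLong w = (3+w)/2`, calibrated on every printed instance) the norms `𝔖_k + ℜ_k` of Definitions
9.4.1–9.4.4 (l.23866–23918: `Σ_*`-flux + `r^{3+δ_B}` bulk; no `C_u`/`Σ(τ)`-flux of `(A,B)`, no `Σ_*`-transport for `P̌, B̲, A̲`)
deliver `(A,B)` at `3+δ_B/2` (deficit `1/2`: `gap9417_AB`, `witness_9417_AB`) and `P̌ / B̲ / A̲` at a deficit `δ_B/2` each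
(`gap9417_P/Bb/Ab`, not among the Remark's two concessions); the inputs that would close it — the `Σ(τ)`-flux at `r^{4+δ_B}`
PROVED inside [GKS] Prop 16.3.1 / §16.4.1 (l.29865–29917, 30033–30055) but exported into neither (13.5.3) nor this theorem, and
`Σ_*`-sourced transport bounds as printed for Schwarzschild in [KS-Schw] §4.4 (arXiv 1711.07597v2 l.8442–8602) — are the U-leaf.
Class E, open-priced (no constant changes; analysis-level), not gate-relevant.  THIS declaration is unchanged: it types the printed
statement; the note records the one consumer step the cell could not re-derive from it.
v11 (carver gen 12; adep1-g10 GAPS.md Block 28 = tree `KlainermanSzeftel2021.CylinderTransportCount`, lead block 29): HALF of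
that input is located in print — [KS] §9.7.1 "Transport lemmas", Prop 9.7.2 / Cor 9.7.3 (l.26366–26414 = [J] Prop 9.8.2 /
Cor 9.8.3, HAL hal-04280491 p0702–p0703): the `Σ_*`-sourced backward `∇₄`-transport in the outgoing PT frame of `ℳext`, stated
for general anti-selfdual tensors (`r^{c−1}‖U‖_{2,k}(u,r) ≲ r_*^{c−1}‖U‖_{2,k}(u,r_*) + ∫_r^{r_*} λ^{c−1}‖F‖_{2,k}` for
`∇₄U + (c/q)U = F`, and its squared / `u`-integrated corollary with `Σ_*` data and an `ℳext` bulk at any `r^{2C}`, `C > c − 1/2`),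
applied to the outgoing Bianchi equations (Prop 2.1.9) delivers (9.4.17)'s exponents `3, 2, 1` of `P̌, B̲, A̲` EXACTLY from
`ℜ*_k` and `^(ext)ℜ_{k+1}` (`served_exactly_RP`: margins `δ_B, 2−δ_B, 2−δ_B`, budget `k ≤ k_large+4` = the printed range;
registry node KS9.7.3; printed low-order instances Prop 6.5.4 Step 4, Prop 6.6.2 Steps 6–7) and does NOT serve `B`
(`notServed_B`, `rescaled_B`).  The U-leaf KS9.4.3-S3-in now names only the statement-level export of the `Σ(τ)`-flux of
`(A,B)` (R-A) and the forward transport upgrade of `B`'s last `δ_B/2` (R-B); class and price of E28 unchanged.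
[cite: KlainermanSzeftel2021, Theorem 9.4.10 (Main PT-Theorem), TeX l.24053–24064] -/
def Thm9410 (I : Ch9Iteration) (C : ℝ) : Prop := ∀ k, k ≤ I.kLarge + 7 → I.S k + I.R k ≤ C * I.ε0

/-- The §9.4.8 iteration as one implication shape, v2 (bookkeeping, real analysis).
v5 — SUPERSEDED SHAPE, kept for the record and offered to nobody (cell GAPS.md K17a, T1–T3): AS TYPED this `Prop` is not
provable for all values of its parameters and for no choice of them is it the content of §9.4.8 — (T1a) `C` is a free
parameter: the instance `C = 0` is false whenever `ε₀ > 0` and some norm is positive, while for a fixed record `∃ C` is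
trivially true; the content of Theorem 9.4.10 is ONE constant depending only on the leaf constants, `r₀`, `δ_B`, `k_large`,
which only an explicit expression can state; (T1b) a single `Citer` in `Cor9421 C21 Citer` cannot run the
`N − 1 ≥ 6` induction steps, whose iteration constant grows at each step — the corollary is needed UNIFORMLY,
`∀ Cᵢ ≥ 0, Cor9421 C21 Cᵢ`; (T1c) `Lemma9422`'s abstract `0 ≤ θ_k ≤ 1` cannot absorb: `0 < θ_{k_large+6} < 1` is needed and
only that instance is used; (T2) `BAch9` (BA-PT (9.4.32)) is not consumed by the bookkeeping at this node — in print its role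
is a-priori finiteness (built into the `ℝ`-typing) and error control INSIDE the leaves Thm 9.4.15 / Props 9.4.17–9.4.20;
(T3) quantifier order: leaf constants independent of `r₀`, then `r₀` large (ONE condition `C21 r₀^{−δ_B} C5 ≤ 1/2`), no `ε₀`
condition at this node.  Two further inputs of the printed proof are the un-numbered displays `L_*(k_small−1) ≲ ε₀`
(l.24684–24687, registry node KS9.4.8-L0) and `L_*(k_large+7) ≲ ℜ_{k_large+7} + 𝔖*_{k_large+7}` (l.24713–24725, node KS9.4.8-L7).
The KERNEL CERTIFICATE of node KS9.4.10 is `Ch9Iteration.thm9410_explicit` (and `thm9410_of_interpAtTop`,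
`thm9410_of_additiveInterp`) in `IterationClosure.lean` of this directory, stated over the leaves above with every constant
explicit; that file imports this one, so the certified shape cannot be restated here without duplication.
[cite: KlainermanSzeftel2021, §9.4.8 proof of Theorem 9.4.10, TeX l.24606–24747] -/
def Thm9410_of_children (I : Ch9Iteration) (C13 C21 Citer C22 C : ℝ) (θ : ℕ → ℝ) : Prop :=
  I.BAch9 → I.Lemma9413 C13 → I.Cor9421 C21 Citer → I.Lemma9422 C22 θ → I.Thm9410 C

end Ch9Iteration

end Literature.Geometry.Lorentzian.KlainermanSzeftel2021
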